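/-
Copyright (c) 2026 the pub-hodgecm-mathlib formalisation cell (harness21).  Prover seat hodgecm-mathlib-F0P3a-p06 (g20), line LH3 letter L3′ SURJ-OF-FORWARD road, organ (Σ-LOC)
«localisation on the stable-class space» (binder∕assembler of record LH10-p01 (g5), «= p06» 2026-09-02T12:42:50Z; LH3-plan (g4) RULINGS #22∕#23); 2026-09-02.
-/
import Literature.NumberTheory.Rogawski1990.ArchBouazizSpace            -- ★ p849634 (LH3-p01 (g3)): `ArchBouazizSpaceH jcH Ψ`, projection `.compactSupport` (clause (I₄) ★ `ArchBzCompactSupport`)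
import Literature.NumberTheory.Rogawski1990.ArchBouazizClassMap         -- ★ p851469 (LH10-p01 (g5)): `bzClassMap`, `BzLocalized` (the SURJ road's vocabulary)
import Literature.Analysis.Calculus.SmoothCutoffLocalization           -- ★ p851476 (this seat): `exists_fin_cutoff_localized_sum_eq` (finite smooth partition of unity + class cutoffs)
import HarnessLib

/-!
# Organ (Σ-LOC) of Bouaziz's surjectivity for `H_∞ = U(1,1)^W × U(1)^W`: every member of `I^st_c(jcH)` is a finite sum of members LOCALISED at base classes, to any prescribed
# radii — from the class-cutoff lemma (Σ3-core) (Bouaziz 1994 §2.3 Lemme 2.3.1, §5.1 p. 588)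

Topic `NumberTheory/Rogawski1990`; namespace `Literature.NumberTheory.Rogawski1990`.  THEOREMS ONLY (no `def`, no instance, no notation, no axiom, no named fact, no `sorry`);
kernel lane `--kind proof --supports stmt-HodgeConjecture-24833`.  Cell `pub/hodgecm-mathlib`, crux H413 = `stmt-HodgeConjecture-24833`; line LH3 (closer stub `stub_N9`), letter
L3′ split «FORWARD ⊕ SURJ-OF-FORWARD» (RULING #22); SURJ assembly `bouazizSurjOfForward_of_parts : (Σ-LOC) → (Σ-LOCAL) → (Σ-ADD) → …` (LH10-p01 (g5) skeleton v2, HOME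
`F0/P3c/LH10/LH10-p01/g5/surj/ArchBouazizSurjectiveAssembly.skeleton.v2.LH10p01g5.lean`).  THIS FILE PAYS **(Σ-LOC) `BzLocalizationStatement` MODULO (Σ3-core) `BzClassCutoffStatement`**:
the head `bzLocalization_of_classCutoff` has type «`BzClassCutoffStatement`'s body → `BzLocalizationStatement`'s body» TOKEN FOR TOKEN, so the skeleton's organ closes by
`bzLocalization_of_classCutoff ‹Σ3-core›`.

THE MATHEMATICS (Bouaziz ÉNS 27 §5.1 p. 588: «si `J_G` est surjective sur une famille d'ouverts complètement invariants recouvrant `U` … `J_G(φ₁ + ⋯ + φₙ) = ψ`», via the invariant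
partition of unity of Lemme 2.3.1).  Stable classes of `H_∞` are read through the per-place class map `bzClassMap S c = (tr, det, u)_w ∈ (W → ℂ × ℂ × ℂ) =: E` (★ p851469), a
finite-dimensional real normed space.  (L-supp, §1) By clause (I₄) (★ `ArchBzCompactSupport`: on each chart `S`, `Ψ S c = 0` once some split coordinate `|c w 0|` exceeds `Rb_S`) and
the sup-norm bound `‖bzClassMap S c‖ ≤ 2·e^{R} + 2` when `|c w 0| ≤ R` at the split places (`eˣ + e⁻ˣ ≤ 2e^{|x|}`; circle entries have norm `1`), the classes of the points where a
member `Ψ` of `I^st_c` does not vanish lie in the compact ball `closedBall 0 (2·e^{R} + 2)`, `R = ∑_S |Rb_S|` (finitely many charts).  (§2) The group-free core ★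
`exists_fin_cutoff_localized_sum_eq` (finite smooth partition of unity `∑ F_i = 1` on that ball subordinate to `{ball b (ε b)}`, pieces `Ψs i := (F_i ∘ bzClassMap) · Ψ`) then splits
`Ψ = ∑ i, Ψs i` AT EVERY chart point (a fortiori on `RegS S`), each `Ψs i` in `I^st_c(jcH)` by the CLASS-CUTOFF lemma (Σ3-core) — the one analytic input, taken as a hypothesis in
the binder's text (`F : E → ℂ` smooth; our real cutoffs are coerced, `Complex.ofRealCLM ∘ F_i`) — and `BzLocalized (Ψs i) (b i) (ε (b i))` because `tsupport F_i ⊆ ball (b i) (ε (b i))`.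

* §1 `norm_bzClassMap_le`, **`exists_isCompact_bzClassMap_mem_of_archBzCompactSupport`** (L-supp).
* §2 **`exists_fin_bzLocalized_sum_eq_of_cutoff`** (one `W`, one `jcH`; cutoff hypothesis only for REAL smooth compactly supported `F`; conclusion with the sum identity at EVERY
  `(S, c)`), **`bzLocalization_of_classCutoff : ‹BzClassCutoffStatement› → ‹BzLocalizationStatement›`** (bodies verbatim).
HONEST LABEL: HC_CM is proved only modulo the 7 printed citations (2 remaining: hLiu418 = `stmt-HodgeConjecture-24832`, h413 = `stmt-HodgeConjecture-24833`) until rung 0 closes;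
this file pays (Σ-LOC) only MODULO (Σ3-core) (count-neutral); Bouaziz's surjectivity itself (Thm. 6.2.1; (Σ5) PRINT per RULING #23) is NOT proved here.

## References
* [Bouaziz1994IntegralesOrbitales] A. Bouaziz, *Intégrales orbitales sur les groupes de Lie réductifs*, Ann. Sci. ÉNS (4) 27 (1994) 573–609, §2.3 Lemme 2.3.1, §3.1 (I₄) p. 579,
  §5.1 p. 588, Thm. 6.2.1 (i) p. 592.
* [Varadarajan1989] V. S. Varadarajan, *An Introduction to Harmonic Analysis on Semisimple Lie Groups*, Cambridge Stud. Adv. Math. 16 (1989), §6 p. 229.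
* [Rogawski1990] J. D. Rogawski, *Automorphic Representations of Unitary Groups in Three Variables*, Ann. of Math. Stud. 123 (1990), §3.6 p. 31, §8.2 p. 122.
-/

set_option autoImplicit false

noncomputable section

open Set Function Metric Complex
open Literature.NumberTheory.Automorphic.ArchCartan
open scoped ContDiff Topology

namespace Literature.NumberTheory.Rogawski1990

/-! ## §1 (L-supp): the classes of the support of a member of `I^st_c` lie in a compact set -/

section Support

variable {W : Type*} [Fintype W] [DecidableEq W]

/-- **Sup-norm bound for the class map** when the split coordinates are bounded: `|c w 0| ≤ R` for `w ∈ S` ⟹ `‖bzClassMap S c‖ ≤ 2·e^{R} + 2` (split entry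
`(eˣ + e⁻ˣ)·e^{iθ}` of norm `eˣ + e⁻ˣ ≤ 2e^{R}`, every other entry a sum∕product∕square of unit complex numbers). [cite: Bouaziz1994IntegralesOrbitales, §3.1 (I₄) p. 579] -/
theorem norm_bzClassMap_le (S : Finset W) (c : W → Fin 3 → ℝ) {R : ℝ} (hR : ∀ w ∈ S, |c w 0| ≤ R) :
    ‖bzClassMap S c‖ ≤ 2 * Real.exp R + 2 := by
  have h2 : (0 : ℝ) ≤ 2 * Real.exp R + 2 := by positivity
  refine (pi_norm_le_iff_of_nonneg h2).2 fun w => ?_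
  have hc1 : ∀ θ : ℝ, ‖(Circle.exp θ : ℂ)‖ ≤ 2 * Real.exp R + 2 := fun θ => by
    rw [Circle.norm_coe]
    linarith [Real.exp_pos R]
  by_cases hw : w ∈ S
  · rw [bzClassMap, if_pos hw]
    refine (norm_prod_le_iff.2 ⟨?_, norm_prod_le_iff.2 ⟨?_, hc1 _⟩⟩)
    · rw [norm_mul, Circle.norm_coe, mul_one, Complex.norm_real, Real.norm_eq_abs,
        abs_of_pos (add_pos (Real.exp_pos _) (Real.exp_pos _))]
      have h1 : Real.exp (c w 0) ≤ Real.exp R := Real.exp_le_exp.2 ((le_abs_self _).trans (hR w hw))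
      have h1' : Real.exp (-(c w 0)) ≤ Real.exp R := Real.exp_le_exp.2 ((neg_le_abs _).trans (hR w hw))
      linarith
    · rw [norm_pow, Circle.norm_coe, one_pow]
      linarith [Real.exp_pos R]
  · rw [bzClassMap, if_neg hw]
    refine (norm_prod_le_iff.2 ⟨?_, norm_prod_le_iff.2 ⟨?_, hc1 _⟩⟩)
    · refine (norm_add_le _ _).trans ?_
      rw [Circle.norm_coe, Circle.norm_coe]
      linarith [Real.exp_pos R]
    · rw [norm_mul, Circle.norm_coe, Circle.norm_coe, mul_one]
      linarith [Real.exp_pos R]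

/-- **(L-supp): the classes of the points where a member of `I^st_c` does not vanish lie in a compact set** — clause (I₄) ★ `ArchBzCompactSupport` gives a bound `Rb_S` on the split
coordinates of the support on each chart `S`; with `R := ∑_S |Rb_S|` (finitely many charts) and `norm_bzClassMap_le`, every such class lies in `closedBall 0 (2·e^{R} + 2)`, compact in the
finite-dimensional space `W → ℂ × ℂ × ℂ`. [cite: Bouaziz1994IntegralesOrbitales, §3.1 (I₄) p. 579; §5.1 p. 588] -/
theorem exists_isCompact_bzClassMap_mem_of_archBzCompactSupport {Ψ : Finset W → (W → Fin 3 → ℝ) → ℂ} (hΨ : ArchBzCompactSupport Ψ) :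
    ∃ K : Set (W → ℂ × ℂ × ℂ), IsCompact K ∧ ∀ (S : Finset W) (c : W → Fin 3 → ℝ), Ψ S c ≠ 0 → bzClassMap S c ∈ K := by
  choose Rb hRb using hΨ
  set R : ℝ := ∑ S : Finset W, |Rb S| with hRdef
  have hRS : ∀ S : Finset W, Rb S ≤ R := fun S =>
    (le_abs_self _).trans (Finset.single_le_sum (f := fun T : Finset W => |Rb T|) (fun T _ => abs_nonneg _) (Finset.mem_univ S))
  refine ⟨closedBall 0 (2 * Real.exp R + 2), isCompact_closedBall _ _, fun S c hc => ?_⟩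
  rw [mem_closedBall, dist_zero_right]
  refine norm_bzClassMap_le S c fun w hw => ?_
  by_contra hlt
  exact hc (hRb S c ⟨w, hw, (hRS S).trans_lt (not_le.1 hlt)⟩)

end Support

/-! ## §2 (Σ-LOC) from the class-cutoff lemma -/

section Localization

variable {W : Type*} [Fintype W] [DecidableEq W]

/-- **LOCALISATION OF ONE MEMBER, from real compactly supported class cutoffs.**  If `I^st_c(jcH)` is stable under the cutoffs `(F ∘ bzClassMap) · Ψ` for every REAL smooth compactly
supported `F` on the class space, then every member `Ψ` splits, for any positive radii `ε`, as `Ψ S c = ∑ i, Ψs i S c` at EVERY chart point, with finitely many members `Ψs i`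
localised at base classes `b i` to radius `ε (b i)` (★ `exists_fin_cutoff_localized_sum_eq` over the compact set of (L-supp)). [cite: Bouaziz1994IntegralesOrbitales, §2.3 Lemme 2.3.1; §5.1 p. 588] -/
theorem exists_fin_bzLocalized_sum_eq_of_cutoff (jcH : Finset W → W → ℂ)
    (hcut : ∀ F : (W → ℂ × ℂ × ℂ) → ℝ, ContDiff ℝ ∞ F → HasCompactSupport F →
      ∀ Ψ : Finset W → (W → Fin 3 → ℝ) → ℂ, ArchBouazizSpaceH jcH Ψ → ArchBouazizSpaceH jcH (fun S c => (F (bzClassMap S c) : ℂ) * Ψ S c))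
    (ε : (W → ℂ × ℂ × ℂ) → ℝ) (hε : ∀ b, 0 < ε b) {Ψ : Finset W → (W → Fin 3 → ℝ) → ℂ} (hΨ : ArchBouazizSpaceH jcH Ψ) :
    ∃ (n : ℕ) (b : Fin n → (W → ℂ × ℂ × ℂ)) (Ψs : Fin n → (Finset W → (W → Fin 3 → ℝ) → ℂ)),
      (∀ i, ArchBouazizSpaceH jcH (Ψs i) ∧ BzLocalized (Ψs i) (b i) (ε (b i))) ∧
      ∀ (S : Finset W) (c : W → Fin 3 → ℝ), Ψ S c = ∑ i, Ψs i S c := by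
  obtain ⟨K, hK, hsupp⟩ := exists_isCompact_bzClassMap_mem_of_archBzCompactSupport hΨ.compactSupport
  obtain ⟨n, b, Ψs, h, hsum⟩ := Literature.Analysis.Calculus.exists_fin_cutoff_localized_sum_eq bzClassMap (ArchBouazizSpaceH jcH) hcut hΨ hK hsupp ε hε
  exact ⟨n, b, Ψs, fun i => ⟨(h i).2.1, (h i).2.2⟩, hsum⟩

/-- **(Σ-LOC) `BzLocalizationStatement` FROM (Σ3-core) `BzClassCutoffStatement`** — the binder's two organ texts, VERBATIM, as hypothesis and conclusion: for every finite `W`, datum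
`jcH`, positive radii `ε` and member `Ψ ∈ I^st_c(jcH)`, finitely many members `Ψs i ∈ I^st_c(jcH)` with `BzLocalized (Ψs i) (b i) (ε (b i))` and `Ψ S = ∑ i, Ψs i S` on `RegS S`
(indeed everywhere).  The complex-valued cutoff hypothesis is applied to the coerced real partition of unity (`Complex.ofRealCLM ∘ F`, smooth).
[cite: Bouaziz1994IntegralesOrbitales, §2.3 Lemme 2.3.1; §5.1 p. 588; Thm. 6.2.1 (i) p. 592] -/
theorem bzLocalization_of_classCutoff
    (hcut : ∀ (W : Type) [Fintype W] [DecidableEq W] (jcH : Finset W → W → ℂ) (F : (W → ℂ × ℂ × ℂ) → ℂ), ContDiff ℝ ∞ F →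
      ∀ Ψ : Finset W → (W → Fin 3 → ℝ) → ℂ, ArchBouazizSpaceH jcH Ψ → ArchBouazizSpaceH jcH (fun S c => F (bzClassMap S c) * Ψ S c)) :
    ∀ (W : Type) [Fintype W] [DecidableEq W] (jcH : Finset W → W → ℂ) (ε : (W → ℂ × ℂ × ℂ) → ℝ), (∀ b, 0 < ε b) →
      ∀ Ψ : Finset W → (W → Fin 3 → ℝ) → ℂ, ArchBouazizSpaceH jcH Ψ →
        ∃ (n : ℕ) (b : Fin n → (W → ℂ × ℂ × ℂ)) (Ψs : Fin n → (Finset W → (W → Fin 3 → ℝ) → ℂ)),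
          (∀ i, ArchBouazizSpaceH jcH (Ψs i) ∧ BzLocalized (Ψs i) (b i) (ε (b i))) ∧
          ∀ S : Finset W, Set.EqOn (Ψ S) (fun c => ∑ i, Ψs i S c) (RegS S) := by
  intro W _ _ jcH ε hε Ψ hΨ
  obtain ⟨n, b, Ψs, h, hsum⟩ := exists_fin_bzLocalized_sum_eq_of_cutoff jcH
    (fun F hF _ Φ hΦ => hcut W jcH (fun Y => (F Y : ℂ)) (Complex.ofRealCLM.contDiff.comp hF) Φ hΦ) ε hε hΨ
  exact ⟨n, b, Ψs, h, fun S c _ => hsum S c⟩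

end Localization

end Literature.NumberTheory.Rogawski1990

end
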